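/-
Copyright: harness tree, Literature layer (sorry-free). b2b-lace enum2-g12 (ENUMERATION SHARD B gen 12),
GAPS G8 (δ2)(i), SEEDCERT_U L4 — computable rational coefficient lists for the certificate instances (M3).
-/
import Literature.Probability.FitznerVanDerHofstad2017.InvSqrtOneSubBracket
import Mathlib.RingTheory.Polynomial.Chebyshev
import Mathlib.Algebra.Polynomial.Roots
import HarnessLib

/-!
# The coefficients of `T_n(1 - 2y) · B_J(y)` as computable rationals

The large-`u` bracket of the tree kernel (`SRWHeatKernelBracket*`) expands
`Pg(y) = T_n(1-2y) B_J(y)`, `B_J(y) = Σ_{j≤J} β_j y^j`, `β_j = binom(2j,j)/4^j`, in powers of `y`.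
Here the coefficients are produced by a COMPUTABLE recursion over `ℚ`, so that a certificate
instance can evaluate them in the kernel (`decide` / `norm_num`) instead of manipulating real
polynomials:

* `tHalfCoeff n k : ℚ` — the coefficient of `y^k` in `T_n(1-2y)`, by the Chebyshev recursion
  `T_{n+2} = 2(1-2y)T_{n+1} - T_n` (`t_{n+2,k} = 2t_{n+1,k} - 4t_{n+1,k-1} - t_{n,k}`);
* `eval_T_one_sub_two_mul_eq_sum` — `T_n(1-2y) = Σ_{k≤n} tHalfCoeff n k · y^k` on `ℝ`;
* `bracketCoeffQ n J i : ℚ` — `Σ_{k≤i} t_{n,k} β'_{i-k}` (`β'_j = β_j` for `j ≤ J`, else `0`);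
* `eval_T_mul_invSqrtPartial_eq_sum` — **`T_n(1-2y) · B_J(y) = Σ_{i<n+J+1} bracketCoeffQ n J i · yⁱ`**
  for every real `y` (the hypothesis `hc` of the coefficient-list interface, discharged once and for all);
* `listPoly`, `eval_listPoly`, `coeff_listPoly`, `natDegree_listPoly_le` — the bookkeeping polynomial
  `Σ_{j<N} C c_j X^j` used in the proof (and by `SRWHeatKernelBracketList`).

References: R. Fitzner, R. van der Hofstad, Electron. J. Probab. 22 (2017), §5.1.1 (5.5), p. 1090
(the expansion of the half-angle integrand). [cite: FitznerVanDerHofstad2016NoBLE, §5.1.1 (5.5) p. 1090];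
T. Hara, G. Slade, Rev. Math. Phys. 4 (1992), Appendix B. [cite: HaraSlade1992b, Appendix B]
-/

open Finset Polynomial Polynomial.Chebyshev
open Literature.Probability.FitznerVanDerHofstad2017

namespace Literature.Probability.LatticeModels

/-! ## The coefficients of `T_n(1-2y)` -/

/-- `tHalfCoeff n k` = coefficient of `y^k` in `T_n(1-2y)` (Chebyshev recursion; computable). [folklore] -/
def tHalfCoeff : ℕ → ℕ → ℚ
  | 0, 0 => 1
  | 0, _ + 1 => 0
  | 1, 0 => 1
  | 1, 1 => -2
  | 1, _ + 2 => 0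
  | n + 2, 0 => 2 * tHalfCoeff (n + 1) 0 - tHalfCoeff n 0
  | n + 2, k + 1 => 2 * tHalfCoeff (n + 1) (k + 1) - 4 * tHalfCoeff (n + 1) k - tHalfCoeff n (k + 1)

/-- `T₀ = 1`: constant coefficient. [folklore] -/
@[simp] theorem tHalfCoeff_zero_zero : tHalfCoeff 0 0 = 1 := rfl
/-- `T₀ = 1`: higher coefficients vanish. [folklore] -/
@[simp] theorem tHalfCoeff_zero_succ (k : ℕ) : tHalfCoeff 0 (k + 1) = 0 := rfl
/-- `T₁(1-2y) = 1 - 2y`: constant coefficient. [folklore] -/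
@[simp] theorem tHalfCoeff_one_zero : tHalfCoeff 1 0 = 1 := rfl
/-- `T₁(1-2y) = 1 - 2y`: linear coefficient. [folklore] -/
@[simp] theorem tHalfCoeff_one_one : tHalfCoeff 1 1 = -2 := rfl
/-- `T₁(1-2y) = 1 - 2y`: higher coefficients vanish. [folklore] -/
@[simp] theorem tHalfCoeff_one_add_two (k : ℕ) : tHalfCoeff 1 (k + 2) = 0 := rfl
/-- The recursion at `k = 0`: `t_{n+2,0} = 2t_{n+1,0} - t_{n,0}`. [folklore] -/
theorem tHalfCoeff_add_two_zero (n : ℕ) :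
    tHalfCoeff (n + 2) 0 = 2 * tHalfCoeff (n + 1) 0 - tHalfCoeff n 0 := rfl
/-- The recursion at `k + 1`: `t_{n+2,k+1} = 2t_{n+1,k+1} - 4t_{n+1,k} - t_{n,k+1}`. [folklore] -/
theorem tHalfCoeff_add_two_succ (n k : ℕ) :
    tHalfCoeff (n + 2) (k + 1)
      = 2 * tHalfCoeff (n + 1) (k + 1) - 4 * tHalfCoeff (n + 1) k - tHalfCoeff n (k + 1) := rfl

/-- `tHalfCoeff n k = 0` for `k > n`. [folklore] -/
theorem tHalfCoeff_eq_zero_of_lt : ∀ n k : ℕ, n < k → tHalfCoeff n k = 0 := by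
  intro n
  induction n using Nat.twoStepInduction with
  | zero => intro k hk; obtain ⟨k, rfl⟩ := Nat.exists_eq_add_one_of_ne_zero (by omega : k ≠ 0); rfl
  | one =>
    intro k hk; obtain ⟨k, rfl⟩ := Nat.exists_eq_add_of_le (show 2 ≤ k by omega)
    rw [show 2 + k = k + 2 by ring]; rfl
  | more n h0 h1 =>
    intro k hk
    obtain ⟨k, rfl⟩ := Nat.exists_eq_add_one_of_ne_zero (by omega : k ≠ 0)
    rw [tHalfCoeff_add_two_succ, h1 (k + 1) (by omega), h1 k (by omega), h0 (k + 1) (by omega)]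
    ring

/-- A sum of `tHalfCoeff n k yᵏ` may be padded with the vanishing coefficients. [folklore] -/
theorem sum_tHalfCoeff_mul_pow_eq (n : ℕ) {N : ℕ} (hN : n + 1 ≤ N) (y : ℝ) :
    ∑ k ∈ range N, (tHalfCoeff n k : ℝ) * y ^ k
      = ∑ k ∈ range (n + 1), (tHalfCoeff n k : ℝ) * y ^ k := by
  symm
  refine Finset.sum_subset (Finset.range_mono hN) fun k _ hk => ?_
  rw [tHalfCoeff_eq_zero_of_lt n k (by simpa using hk)]
  simp

/-- **`T_n(1-2y) = Σ_{k≤n} tHalfCoeff n k · yᵏ`** on `ℝ`. [folklore] -/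
theorem eval_T_one_sub_two_mul_eq_sum : ∀ (n : ℕ) (y : ℝ),
    (T ℝ n).eval (1 - 2 * y) = ∑ k ∈ range (n + 1), (tHalfCoeff n k : ℝ) * y ^ k := by
  intro n
  induction n using Nat.twoStepInduction with
  | zero => intro y; simp
  | one => intro y; simp [Finset.sum_range_succ]; ring
  | more n h0 h1 =>
    intro y
    have hT : T ℝ ((n + 2 : ℕ) : ℤ) = 2 * X * T ℝ ((n + 1 : ℕ) : ℤ) - T ℝ (n : ℤ) := by
      have := T_add_two (R := ℝ) (n : ℤ)
      push_cast at this ⊢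
      exact this
    rw [hT, eval_sub, eval_mul, eval_mul, eval_X, eval_ofNat, h1 y, h0 y]
    -- pad the two previous expansions to `range (n+3)` and peel off `k = 0`
    rw [← sum_tHalfCoeff_mul_pow_eq n (show n + 1 ≤ n + 3 by omega) y]
    have e1 : ∑ k ∈ range (n + 2), (tHalfCoeff (n + 1) k : ℝ) * y ^ k
        = ∑ k ∈ range (n + 3), (tHalfCoeff (n + 1) k : ℝ) * y ^ k :=
      (sum_tHalfCoeff_mul_pow_eq (n + 1) (show n + 2 ≤ n + 3 by omega) y).symm
    have split : (2 : ℝ) * (1 - 2 * y)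
        * ∑ k ∈ range (n + 2), (tHalfCoeff (n + 1) k : ℝ) * y ^ k
        = 2 * ∑ k ∈ range (n + 3), (tHalfCoeff (n + 1) k : ℝ) * y ^ k
          - 4 * y * ∑ k ∈ range (n + 2), (tHalfCoeff (n + 1) k : ℝ) * y ^ k := by
      rw [← e1]; ring
    rw [split, Finset.sum_range_succ' (fun k => (tHalfCoeff (n + 2) k : ℝ) * y ^ k),
      Finset.sum_range_succ' (fun k => (tHalfCoeff (n + 1) k : ℝ) * y ^ k),
      Finset.sum_range_succ' (fun k => (tHalfCoeff n k : ℝ) * y ^ k)]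
    have hterm : ∀ k ∈ range (n + 2), (tHalfCoeff (n + 2) (k + 1) : ℝ) * y ^ (k + 1)
        = 2 * ((tHalfCoeff (n + 1) (k + 1) : ℝ) * y ^ (k + 1))
          - 4 * y * ((tHalfCoeff (n + 1) k : ℝ) * y ^ k)
          - (tHalfCoeff n (k + 1) : ℝ) * y ^ (k + 1) := by
      intro k _
      rw [tHalfCoeff_add_two_succ]; push_cast; ring
    rw [Finset.sum_congr rfl hterm, Finset.sum_sub_distrib, Finset.sum_sub_distrib,
      ← Finset.mul_sum, ← Finset.mul_sum, tHalfCoeff_add_two_zero]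
    push_cast
    ring

/-- The same expansion for a negative index (`T_{-n} = T_n`). [folklore] -/
theorem eval_T_neg_one_sub_two_mul_eq_sum (n : ℕ) (y : ℝ) :
    (T ℝ (-(n : ℤ))).eval (1 - 2 * y) = ∑ k ∈ range (n + 1), (tHalfCoeff n k : ℝ) * y ^ k := by
  rw [T_neg, eval_T_one_sub_two_mul_eq_sum]

/-! ## The coefficients of `B_J` and of the product -/

/-- `β_j = binom(2j,j)/4^j` as a rational, by the cheap ratio recursion `β₀ = 1`,
`β_{j+1} = β_j (2j+1)/(2j+2)` (kernel-evaluable; no binomial recursion). [folklore] -/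
def invSqrtCoeffQ : ℕ → ℚ
  | 0 => 1
  | j + 1 => invSqrtCoeffQ j * (2 * j + 1) / (2 * j + 2)

/-- `invSqrtCoeffQ j = binom(2j,j)/4^j`. [folklore] -/
theorem invSqrtCoeffQ_eq (j : ℕ) : invSqrtCoeffQ j = (Nat.centralBinom j : ℚ) / 4 ^ j := by
  induction j with
  | zero => simp [invSqrtCoeffQ]
  | succ j ih =>
    rw [invSqrtCoeffQ, ih]
    have h := Nat.succ_mul_centralBinom_succ j
    have h' : ((j + 1 : ℕ) : ℚ) * (Nat.centralBinom (j + 1) : ℚ)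
        = 2 * (2 * j + 1) * (Nat.centralBinom j : ℚ) := by exact_mod_cast h
    have hj : ((j : ℚ) + 1) ≠ 0 := by positivity
    rw [pow_succ]
    field_simp
    push_cast at h' ⊢
    nlinarith [h']

/-- Cast: `invSqrtCoeff j = (invSqrtCoeffQ j : ℝ)`. [folklore] -/
theorem invSqrtCoeff_eq_cast (j : ℕ) : invSqrtCoeff j = ((invSqrtCoeffQ j : ℚ) : ℝ) := by
  rw [invSqrtCoeffQ_eq]; simp [invSqrtCoeff]

/-- The truncated coefficient `β'_j = β_j` for `j ≤ J`, `0` beyond. [folklore] -/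
def invSqrtCoeffQ' (J j : ℕ) : ℚ := if j ≤ J then invSqrtCoeffQ j else 0

/-- `B_J(y) = Σ_{j<J+1} β_j y^j` with rational coefficients. [folklore] -/
theorem invSqrtPartial_eq_sum_cast (J : ℕ) (y : ℝ) :
    invSqrtPartial J y = ∑ j ∈ range (J + 1), ((invSqrtCoeffQ j : ℚ) : ℝ) * y ^ j := by
  simp [invSqrtPartial, invSqrtCoeff_eq_cast]

/-- **The coefficient of `yⁱ` in `T_n(1-2y) B_J(y)`**: `Σ_{k≤i} t_{n,k} β'_{i-k}` (computable). [folklore] -/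
def bracketCoeffQ (n J i : ℕ) : ℚ :=
  ∑ k ∈ range (i + 1), tHalfCoeff n k * invSqrtCoeffQ' J (i - k)

/-- Sanity / documentation: the coefficients of `T₆(1-2y)` (the largest index a seed certificate
needs), evaluated in the kernel. [folklore] -/
theorem map_tHalfCoeff_six :
    (List.range 7).map (tHalfCoeff 6) = [1, -72, 840, -3584, 6912, -6144, 2048] := by
  decide +kernel

/-- Sanity / documentation: `(1-2y)(1 + y/2 + 3y²/8) = 1 - (3/2)y - (5/8)y² - (3/4)y³`,
i.e. `bracketCoeffQ 1 2 = [1, -3/2, -5/8, -3/4]`, evaluated in the kernel. [folklore] -/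
theorem map_bracketCoeffQ_one_two :
    (List.range 4).map (bracketCoeffQ 1 2) = [1, -3 / 2, -5 / 8, -3 / 4] := by
  decide +kernel

/-! ## Bookkeeping: the polynomial with a given coefficient list -/

/-- The polynomial with coefficient list `c₀,…,c_{N-1}`. [folklore] -/
noncomputable def listPoly (c : ℕ → ℝ) (N : ℕ) : ℝ[X] :=
  ∑ j ∈ range N, Polynomial.C (c j) * Polynomial.X ^ j

/-- `listPoly c N` evaluates to `Σ_{i<N} c_i yⁱ`. [folklore] -/
theorem eval_listPoly (c : ℕ → ℝ) (N : ℕ) (y : ℝ) :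
    (listPoly c N).eval y = ∑ i ∈ range N, c i * y ^ i := by
  simp [listPoly, Polynomial.eval_finsetSum]

/-- The coefficients of `listPoly c N`. [folklore] -/
theorem coeff_listPoly (c : ℕ → ℝ) (N i : ℕ) :
    (listPoly c N).coeff i = if i < N then c i else 0 := by
  rw [listPoly, finsetSum_coeff]
  simp_rw [coeff_C_mul_X_pow]
  rw [Finset.sum_ite_eq (range N) i c]
  simp [Finset.mem_range]

/-- `natDegree (listPoly c N) ≤ N - 1` (in the form `< N` when `0 < N`, `≤ N` always). [folklore] -/
theorem natDegree_listPoly_le (c : ℕ → ℝ) (N : ℕ) : (listPoly c N).natDegree ≤ N := by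
  rw [natDegree_le_iff_coeff_eq_zero]
  intro i hi
  rw [coeff_listPoly, if_neg (by omega)]

/-- **`T_n(1-2y) · B_J(y) = Σ_{i<n+J+1} bracketCoeffQ n J i · yⁱ`** for every real `y`.
[cite: FitznerVanDerHofstad2016NoBLE, §5.1.1 (5.5) p. 1090] -/
theorem eval_T_mul_invSqrtPartial_eq_sum (n J : ℕ) (y : ℝ) :
    (T ℝ n).eval (1 - 2 * y) * invSqrtPartial J y
      = ∑ i ∈ range (n + J + 1), ((bracketCoeffQ n J i : ℚ) : ℝ) * y ^ i := by
  -- the two factors as `listPoly`s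
  set p : ℝ[X] := listPoly (fun k => (tHalfCoeff n k : ℝ)) (n + 1) with hp
  set q : ℝ[X] := listPoly (fun j => ((invSqrtCoeffQ j : ℚ) : ℝ)) (J + 1) with hq
  have hpe : (T ℝ n).eval (1 - 2 * y) = p.eval y := by
    rw [eval_T_one_sub_two_mul_eq_sum, hp, eval_listPoly]
  have hqe : invSqrtPartial J y = q.eval y := by
    rw [invSqrtPartial_eq_sum_cast, hq, eval_listPoly]
  rw [hpe, hqe, ← eval_mul]
  -- expand `p * q` over `range (n + J + 1)`
  have hdeg : (p * q).natDegree < n + J + 1 := by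
    by_cases h0 : p * q = 0
    · rw [h0, natDegree_zero]; omega
    have hp0 : p ≠ 0 := fun h => h0 (by rw [h, zero_mul])
    have hq0 : q ≠ 0 := fun h => h0 (by rw [h, mul_zero])
    have h1 : p.natDegree ≤ n := by
      rw [natDegree_le_iff_coeff_eq_zero]; intro i hi
      rw [hp, coeff_listPoly, if_neg (by omega)]
    have h2 : q.natDegree ≤ J := by
      rw [natDegree_le_iff_coeff_eq_zero]; intro i hi
      rw [hq, coeff_listPoly, if_neg (by omega)]
    calc (p * q).natDegree ≤ p.natDegree + q.natDegree := natDegree_mul_le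
      _ < n + J + 1 := by omega
  rw [eval_eq_sum_range' hdeg]
  refine Finset.sum_congr rfl fun i _ => ?_
  congr 1
  rw [coeff_mul, Finset.Nat.sum_antidiagonal_eq_sum_range_succ_mk, bracketCoeffQ]
  push_cast
  refine Finset.sum_congr rfl fun k hk => ?_
  simp only [Finset.mem_range] at hk
  rw [hp, hq, coeff_listPoly, coeff_listPoly, invSqrtCoeffQ']
  by_cases hkn : k < n + 1
  · rw [if_pos hkn]
    by_cases hj : i - k ≤ J
    · rw [if_pos (by omega), if_pos hj]
    · rw [if_neg (by omega), if_neg hj]; push_cast; ring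
  · rw [if_neg hkn, tHalfCoeff_eq_zero_of_lt n k (by omega)]; push_cast; ring

/-- The same identity for a negative Chebyshev index. [folklore] -/
theorem eval_T_neg_mul_invSqrtPartial_eq_sum (n J : ℕ) (y : ℝ) :
    (T ℝ (-(n : ℤ))).eval (1 - 2 * y) * invSqrtPartial J y
      = ∑ i ∈ range (n + J + 1), ((bracketCoeffQ n J i : ℚ) : ℝ) * y ^ i := by
  rw [T_neg, eval_T_mul_invSqrtPartial_eq_sum]

end Literature.Probability.LatticeModels
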